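import Summits.Schanuel.Schanuel.Theorems.ZilberEacStripEscape
import Summits.Schanuel.Schanuel.Theorems.ZilberEacLineCurveEscape
import HarnessLib

/-!
# Logarithmic strips, V-a: the escaping root sequence over a line of non-real slope

HONEST FRAMING.  Cell `pub-schanuel` (Zilber's Exponential-Algebraic Closedness, case ladder;
host summit Schanuel), seat 2, gen 17.  Bookkeeping for non-split surfaces
`{x₁ = ax₀ + b, P(x₀; y₀, y₁) = 0}` over a line of NON-REAL slope: the degree-one corrected roots
`αz₀ + β - μL = 2πi s(k+1) + c₀` (`α = a + s₀`, `Im α = Im a ≠ 0`, `exists_lineRoot_log_seq`) with the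
sign `s = -sgn Im α` escape linearly to the LEFT: `Re z₀(k) ≤ -κ₁ t_k`, `‖z₀(k)‖ ≤ A t_k`, `t_k → ∞`
(`exists_lineRoot_seq_escape`); a polynomial-times-exponential decay lemma and a scaled
logarithm-ratio bound.  NOT Schanuel's conjecture (neither used nor implied; EAC ⇏ SC); `EC(3,2)`
stays OPEN; Mantova–Masser's density question (PLMS 2024, §1 p. 5) stays OPEN in general.
-/

noncomputable section

open Filter Topology Metric Set Complex
open Literature.ModelTheory.Zilber

set_option linter.dupNamespace false

namespace Summit.Schanuel.Schanuel.Theorems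

/-! ## Part A. Two estimates -/

/-- `(A t + B)^N e^{-c t} → 0` as `t → ∞` (`c > 0`). [folklore] -/
theorem tendsto_affinePow_mul_exp_neg (A B : ℝ) {c : ℝ} (hc : 0 < c) (N : ℕ) :
    Tendsto (fun t : ℝ => (A * t + B) ^ N * Real.exp (-(c * t))) atTop (𝓝 0) := by
  have hb : Tendsto (fun x : ℝ => x ^ N * Real.exp (-x)) atTop (𝓝 0) :=
    Real.tendsto_pow_mul_exp_neg_atTop_nhds_zero N
  have hb' : Tendsto (fun t : ℝ => (c * t) ^ N * Real.exp (-(c * t))) atTop (𝓝 0) :=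
    hb.comp (tendsto_id.const_mul_atTop hc)
  set C : ℝ := (|A| + |B|) / c with hC
  refine squeeze_zero_norm' ?_ (by simpa using hb'.const_mul (C ^ N))
  filter_upwards [eventually_ge_atTop (1 : ℝ)] with t ht
  rw [norm_mul, norm_pow, Real.norm_eq_abs, Real.norm_eq_abs, abs_of_pos (Real.exp_pos _)]
  have h1 : |A * t + B| ≤ C * (c * t) := by
    rw [hC, div_mul_eq_mul_div, mul_comm c t, ← mul_assoc, mul_div_assoc, div_self hc.ne', mul_one]
    calc |A * t + B| ≤ |A * t| + |B| := abs_add_le _ _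
      _ = |A| * t + |B| := by rw [abs_mul, abs_of_pos (by linarith : (0 : ℝ) < t)]
      _ ≤ |A| * t + |B| * t := by nlinarith [abs_nonneg B]
      _ = (|A| + |B|) * t := by ring
  have hC0 : 0 ≤ C := by rw [hC]; positivity
  calc |A * t + B| ^ N * Real.exp (-(c * t)) ≤ (C * (c * t)) ^ N * Real.exp (-(c * t)) :=
        mul_le_mul_of_nonneg_right (pow_le_pow_left₀ (abs_nonneg _) h1 N) (Real.exp_nonneg _)
    _ = C ^ N * ((c * t) ^ N * Real.exp (-(c * t))) := by rw [mul_pow]; ring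

/-- **Scaled logarithm ratio**: `‖z - z₀‖ ≤ ρ`, `‖z₀‖ ≥ 16ρ`, `ρ > 0` ⟹
`|log ‖z‖ - log ‖z₀‖| ≤ 1/8`. [folklore] -/
theorem abs_log_norm_sub_log_norm_le_of_scale {z z₀ : ℂ} {ρ : ℝ} (hρ : 0 < ρ)
    (hz₀ : 16 * ρ ≤ ‖z₀‖) (h : ‖z - z₀‖ ≤ ρ) :
    |Real.log ‖z‖ - Real.log ‖z₀‖| ≤ 1 / 8 := by
  have hz₀' : 16 ≤ ‖z₀ / ρ‖ := by
    rw [norm_div, Complex.norm_real, Real.norm_eq_abs, abs_of_pos hρ, le_div_iff₀ hρ]; linarith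
  have h' : ‖z / ρ - z₀ / ρ‖ ≤ 1 := by
    rw [← sub_div, norm_div, Complex.norm_real, Real.norm_eq_abs, abs_of_pos hρ, div_le_one hρ]
    exact h
  have hz0 : ‖z‖ ≠ 0 := by
    have := norm_sub_norm_le z₀ z
    rw [norm_sub_rev] at this
    intro h0; rw [h0] at this; linarith
  have hz₀0 : ‖z₀‖ ≠ 0 := by intro h0; rw [h0] at hz₀; linarith
  have key := abs_log_norm_sub_log_norm_le hz₀' h'
  rw [norm_div, norm_div, Complex.norm_real, Real.norm_eq_abs, abs_of_pos hρ,
    Real.log_div hz0 hρ.ne', Real.log_div hz₀0 hρ.ne'] at key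
  have e : Real.log ‖z‖ - Real.log ρ - (Real.log ‖z₀‖ - Real.log ρ) =
      Real.log ‖z‖ - Real.log ‖z₀‖ := by ring
  rwa [e] at key

/-! ## Part B. The escaping root sequence for a line of non-real slope -/

/-- **Escaping degree-one corrected roots.**  `Im α ≠ 0`, `β c₀ ∈ ℂ`, `μ ∈ ℝ`: with the sign
`s = -sgn(Im α)` the roots of `exists_lineRoot_log_seq` satisfy, for a parameter `t_k → ∞`
(`t_k ≥ 1`): `e^{L} = z₀`, `e^{αz₀+β} = e^{c₀}e^{μL}`, `Re(αz₀ + β) = Re c₀ + μ log‖z₀‖`,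
`Re z₀(k) ≤ -κ₁ t_k`, `‖z₀(k)‖ ≤ A t_k` and `‖z₀(k)‖ ≥ R` for any prescribed `R`
(`κ₁, A > 0`). (new) -/
theorem exists_lineRoot_seq_escape (α : ℂ) (hα : α.im ≠ 0) (β c₀ : ℂ) (μ R : ℝ) :
    ∃ (t : ℕ → ℝ) (z₀ Lg : ℕ → ℂ) (κ₁ A : ℝ), 0 < κ₁ ∧ 0 < A ∧ Tendsto t atTop atTop ∧ ∀ k,
      exp (Lg k) = z₀ k ∧ exp (α * z₀ k + β) = exp c₀ * exp ((μ : ℂ) * Lg k) ∧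
      (α * z₀ k + β).re = c₀.re + μ * Real.log ‖z₀ k‖ ∧ 1 ≤ t k ∧
      (z₀ k).re ≤ -(κ₁ * t k) ∧ ‖z₀ k‖ ≤ A * t k ∧ R ≤ ‖z₀ k‖ := by
  have hα0 : α ≠ 0 := by rintro rfl; exact hα (by simp)
  have hαpos : 0 < ‖α‖ := norm_pos_iff.2 hα0
  have hnsq : 0 < Complex.normSq α := Complex.normSq_pos.2 hα0
  -- the sign and the rate
  set s : ℤ := if 0 < α.im then -1 else 1 with hs_def
  have hs : s = 1 ∨ s = -1 := by rw [hs_def]; split_ifs <;> simp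
  have hsim : (s : ℝ) * α.im < 0 := by
    rw [hs_def]
    split_ifs with h
    · push_cast; linarith
    · have : α.im < 0 := lt_of_le_of_ne (not_lt.1 h) hα
      push_cast; linarith
  set κ₀ : ℝ := -(2 * Real.pi * s * (α.im / Complex.normSq α)) with hκ₀_def
  have hκ₀ : 0 < κ₀ := by
    rw [hκ₀_def]
    have : 2 * Real.pi * s * (α.im / Complex.normSq α) =
        (2 * Real.pi / Complex.normSq α) * (s * α.im) := by ring
    rw [this]
    have h2 : 0 < 2 * Real.pi / Complex.normSq α := div_pos Real.two_pi_pos hnsq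
    nlinarith
  obtain ⟨K₀, z₀, Lg, hroot⟩ := exists_lineRoot_log_seq α hα0 β c₀ μ s hs
  -- notation: `t_k = k + K₀ + 1`, `w_k = t_k s·2πi + c₀ - β`
  set t : ℕ → ℝ := fun k => ((k + K₀ : ℕ) : ℝ) + 1 with ht
  have ht1 : ∀ k, 1 ≤ t k := fun k => by
    simp only [ht]; have : (0 : ℝ) ≤ ((k + K₀ : ℕ) : ℝ) := Nat.cast_nonneg _; linarith
  have htt : Tendsto t atTop atTop := by
    have h := (tendsto_natCast_add_atTop 1).comp (tendsto_add_atTop_nat K₀)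
    refine h.congr fun k => ?_
    simp only [ht, Function.comp_apply, Nat.cast_add]
  set w : ℕ → ℂ := fun k => ((((k + K₀ + 1 : ℕ) : ℤ) * s : ℤ) : ℂ) * (2 * Real.pi * I) + c₀ - β
    with hw
  have hw_eq : ∀ k, w k = (2 * Real.pi * s * t k : ℝ) * I + (c₀ - β) := by
    intro k; simp only [hw, ht]; push_cast; ring
  -- the real part of `w/α`
  have hre_w : ∀ k, (w k / α).re = -(κ₀ * t k) + ((c₀ - β) / α).re := by
    intro k
    rw [hw_eq, add_div, Complex.add_re, show ((2 * Real.pi * s * t k : ℝ) : ℂ) * I / α =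
      ((2 * Real.pi * s * t k : ℝ) : ℂ) * (I / α) by ring, Complex.re_ofReal_mul, gce_re_I_div,
      hκ₀_def]
    ring
  -- bounds from the root lemma
  have hLz : ∀ k, exp (Lg k) = z₀ k := fun k => (hroot k).1
  have heq : ∀ k, α * z₀ k = w k + μ * Lg k := by
    intro k; have := (hroot k).2.1; simp only [hw]; linear_combination this
  have hwlo : ∀ k, 2 * Real.pi * t k - ‖c₀ - β‖ ≤ ‖w k‖ := fun k => (hroot k).2.2.2.2.2.2.1
  have hwhi : ∀ k, ‖w k‖ ≤ 2 * Real.pi * t k + ‖c₀ - β‖ := fun k => (hroot k).2.2.2.2.2.2.2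
  have hdist : ∀ k, ‖z₀ k - w k / α‖ ≤ (‖α‖ + |μ| * (Real.log (‖w k‖ / ‖α‖) + 4)) / ‖α‖ :=
    fun k => (hroot k).2.2.2.1
  have hbig : ∀ k, ‖w k‖ / ‖α‖ / 2 ≤ ‖z₀ k‖ := fun k => (hroot k).2.2.2.2.2.1
  have hReL : ∀ k, (Lg k).re = Real.log ‖z₀ k‖ := fun k => re_eq_log_norm_of_exp_eq (hLz k)
  have hexp : ∀ k, exp (α * z₀ k + β) = exp c₀ * exp ((μ : ℂ) * Lg k) := by
    intro k
    rw [(hroot k).2.1, Complex.exp_add, Complex.exp_add, Complex.exp_int_mul_two_pi_mul_I, one_mul]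
  have hre_eq : ∀ k, (α * z₀ k + β).re = c₀.re + μ * Real.log ‖z₀ k‖ := by
    intro k
    have e : α * z₀ k + β = (2 * Real.pi * s * t k : ℝ) * I + c₀ + μ * Lg k := by
      rw [heq k, hw_eq k]; ring
    rw [e, Complex.add_re, Complex.add_re, Complex.re_ofReal_mul, Complex.I_re, mul_zero, zero_add,
      Complex.re_ofReal_mul, hReL]
  -- eventual size conditions
  set C : ℝ := ‖c₀ - β‖ with hC
  have hC0 : 0 ≤ C := norm_nonneg _
  have hμ0 : 0 ≤ |μ| := abs_nonneg μ
  have hwt : Tendsto (fun k => ‖w k‖ / ‖α‖) atTop atTop := by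
    refine tendsto_atTop_mono (fun k => div_le_div_of_nonneg_right (hwlo k) hαpos.le) ?_
    exact (tendsto_atTop_add_const_right _ _ (htt.const_mul_atTop Real.two_pi_pos)).atTop_div_const
      hαpos
  set ε : ℝ := κ₀ * ‖α‖ ^ 2 / (4 * (|μ| + 1) * (2 * Real.pi)) with hε
  have hεpos : 0 < ε := by positivity
  have hεμ : |μ| * ε * (2 * Real.pi) / ‖α‖ ^ 2 ≤ κ₀ / 4 := by
    rw [hε, div_le_iff₀ (by positivity)]
    have hden : 0 < 4 * (|μ| + 1) * (2 * Real.pi) := by positivity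
    rw [show |μ| * (κ₀ * ‖α‖ ^ 2 / (4 * (|μ| + 1) * (2 * Real.pi))) * (2 * Real.pi) =
      (|μ| / (|μ| + 1)) * (κ₀ / 4 * ‖α‖ ^ 2) by field_simp]
    have : |μ| / (|μ| + 1) ≤ 1 := by rw [div_le_one (by positivity)]; linarith
    exact le_trans (mul_le_mul_of_nonneg_right this (by positivity)) (by linarith)
  have hlog : ∀ᶠ x : ℝ in atTop, Real.log x ≤ ε * x := by
    have h := Real.isLittleO_log_id_atTop.bound hεpos
    filter_upwards [h, eventually_ge_atTop (1 : ℝ)] with x hx hx1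
    simp only [Real.norm_eq_abs, id] at hx
    rw [abs_of_nonneg (by linarith : (0 : ℝ) ≤ x)] at hx
    exact (le_abs_self _).trans hx
  have hev1 := hwt.eventually hlog
  set Const : ℝ := ‖(c₀ - β) / α‖ + 1 + 4 * |μ| / ‖α‖ + |μ| * ε * C / ‖α‖ ^ 2 + C / ‖α‖
    with hConst
  have hev2 : ∀ᶠ k in atTop, Const ≤ κ₀ / 4 * t k :=
    (htt.const_mul_atTop (by positivity : (0 : ℝ) < κ₀ / 4)).eventually_ge_atTop Const
  have hev3 : ∀ᶠ k in atTop, R ≤ (2 * Real.pi * t k - C) / ‖α‖ / 2 :=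
    (((tendsto_atTop_add_const_right _ (-C) (htt.const_mul_atTop Real.two_pi_pos)).atTop_div_const
      hαpos).atTop_div_const (by norm_num : (0 : ℝ) < 2)).eventually_ge_atTop R |>.mono
      fun k hk => by simpa [sub_eq_add_neg] using hk
  obtain ⟨K₂, hK₂⟩ := eventually_atTop.1 (hev1.and (hev2.and hev3))
  -- the pointwise consequences at stage `k + K₂`
  have hpt : ∀ k, K₂ ≤ k → (z₀ k).re ≤ -(κ₀ / 2 * t k) ∧
      ‖z₀ k‖ ≤ (2 * Real.pi / ‖α‖ + κ₀ / 2 + C / ‖α‖) * t k ∧ R ≤ ‖z₀ k‖ := by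
    intro k hk
    obtain ⟨h1, h2, h3⟩ := hK₂ k hk
    have htk := ht1 k
    -- the distance bound, made linear in `t`
    have hr : ‖z₀ k - w k / α‖ ≤ 1 + 4 * |μ| / ‖α‖ + |μ| * ε * C / ‖α‖ ^ 2 + κ₀ / 4 * t k := by
      refine (hdist k).trans ?_
      have e1 : (‖α‖ + |μ| * (Real.log (‖w k‖ / ‖α‖) + 4)) / ‖α‖ =
          1 + 4 * |μ| / ‖α‖ + |μ| * Real.log (‖w k‖ / ‖α‖) / ‖α‖ := by
        field_simp
        ring
      rw [e1]
      have e2 : |μ| * Real.log (‖w k‖ / ‖α‖) / ‖α‖ ≤ |μ| * (ε * (‖w k‖ / ‖α‖)) / ‖α‖ :=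
        div_le_div_of_nonneg_right (mul_le_mul_of_nonneg_left h1 hμ0) hαpos.le
      have e3 : |μ| * (ε * (‖w k‖ / ‖α‖)) / ‖α‖ ≤ |μ| * (ε * ((2 * Real.pi * t k + C) / ‖α‖)) / ‖α‖ :=
        div_le_div_of_nonneg_right (mul_le_mul_of_nonneg_left
          (mul_le_mul_of_nonneg_left (div_le_div_of_nonneg_right (hwhi k) hαpos.le) hεpos.le) hμ0)
          hαpos.le
      have e4 : |μ| * (ε * ((2 * Real.pi * t k + C) / ‖α‖)) / ‖α‖ =
          (|μ| * ε * (2 * Real.pi) / ‖α‖ ^ 2) * t k + |μ| * ε * C / ‖α‖ ^ 2 := by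
        field_simp
      have e5 : (|μ| * ε * (2 * Real.pi) / ‖α‖ ^ 2) * t k ≤ κ₀ / 4 * t k :=
        mul_le_mul_of_nonneg_right hεμ (by linarith)
      linarith
    have hre : (z₀ k).re ≤ (w k / α).re + ‖z₀ k - w k / α‖ := by
      have := re_le_norm (z₀ k - w k / α)
      rw [Complex.sub_re] at this; linarith
    have hC₀ : ((c₀ - β) / α).re ≤ ‖(c₀ - β) / α‖ := re_le_norm _
    refine ⟨?_, ?_, h3.trans ?_⟩
    · rw [hre_w] at hre
      have : Const ≤ κ₀ / 4 * t k := h2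
      rw [hConst] at this
      have hCα : 0 ≤ C / ‖α‖ := by positivity
      linarith
    · have hn : ‖z₀ k‖ ≤ ‖w k / α‖ + ‖z₀ k - w k / α‖ := norm_le_insert' _ _
      rw [norm_div] at hn
      have hw' : ‖w k‖ / ‖α‖ ≤ (2 * Real.pi * t k + C) / ‖α‖ :=
        div_le_div_of_nonneg_right (hwhi k) hαpos.le
      have e6 : (2 * Real.pi * t k + C) / ‖α‖ = 2 * Real.pi / ‖α‖ * t k + C / ‖α‖ := by
        field_simp
      have : Const ≤ κ₀ / 4 * t k := h2
      rw [hConst] at this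
      have hCt : 0 ≤ C / ‖α‖ * t k := by positivity
      have h0 : 0 ≤ ‖(c₀ - β) / α‖ := norm_nonneg _
      have e7 : (2 * Real.pi / ‖α‖ + κ₀ / 2 + C / ‖α‖) * t k =
          2 * Real.pi / ‖α‖ * t k + κ₀ / 2 * t k + C / ‖α‖ * t k := by ring
      rw [e7]
      linarith
    · have := hbig k
      have hw' : (2 * Real.pi * t k - C) / ‖α‖ ≤ ‖w k‖ / ‖α‖ :=
        div_le_div_of_nonneg_right (hwlo k) hαpos.le
      linarith
  refine ⟨fun k => t (k + K₂), fun k => z₀ (k + K₂), fun k => Lg (k + K₂), κ₀ / 2,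
    2 * Real.pi / ‖α‖ + κ₀ / 2 + C / ‖α‖, by positivity, by positivity,
    htt.comp (tendsto_add_atTop_nat K₂), fun k => ⟨hLz _, hexp _, hre_eq _, ht1 _, ?_, ?_, ?_⟩⟩
  · exact (hpt (k + K₂) (Nat.le_add_left _ _)).1
  · exact (hpt (k + K₂) (Nat.le_add_left _ _)).2.1
  · exact (hpt (k + K₂) (Nat.le_add_left _ _)).2.2

end Summit.Schanuel.Schanuel.Theorems
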